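import Summits.Ventures.Crystal3D.Theorems.StickyWulffConstantNoReconstructionGainExactLatticeFilm
import HarnessLib

/-!
# The off-lattice part of a criminal has more than three contacts per ball (line `replication-exactness`)

HONEST FRAMING. Part of the venture `Summits/Ventures/Crystal3D` (cell `crystal3d-full`), supports the
crux `NoReconstructionGain` (stmt-Ventures-19144, route `route-Ventures-StickyWulffConstant`), line
`replication-exactness` (lead wulff-p1 g17).  One more necessary feature of a criminal (a minimal
counterexample to EXACT₀), from the block inequality applied to the block of its OFF-LATTICE balls:

* `plug_add_onLattice_le_three` — an off-lattice film ball has at most `3` contacts with lattice sites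
  (substrate plugs and on-lattice film partners together; `fcc_offLattice_unitContacts_le_three`);
* `contactDeficiency_offLattice_lt_of_criminal` — **in a criminal, the off-lattice block `Q_off` satisfies
  `D(Q_off) < 3·#Q_off`, i.e. it has MORE THAN `3·#Q_off` internal contacts (average coordination `> 6`
  inside the off-lattice part alone)**: the block inequality `D(U) < X(H,U) + e(Q∖U,U)` at `U = Q_off`,
  where the right-hand side counts lattice contacts of off-lattice balls, `≤ 3` each.

So the off-lattice skeleton of a criminal is a genuinely three-dimensional dense packing (no planar or
monolayer structure has `> 3n − 6` unit contacts); with the contact-number tables this forces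
`#Q_off ≥ 17` (`C(n) ≤ 3n` for `n ≤ 16`, not formalised here).

WHAT THIS IS NOT: the crux; rung F-C1 not moved.
-/

noncomputable section

namespace Summit.Ventures.Crystal3D.Theorems

open Summit.Ventures.Crystal3D
open Literature.MathematicalPhysics.StatisticalMechanics (fccStacking contactDeficiency orderedContacts)
open scoped InnerProductSpace
open Finset

open scoped Classical in
/-- An off-lattice film ball has at most three contacts with lattice sites: plugs plus on-lattice film
partners. -/
theorem plug_add_onLattice_le_three {ν : EuclideanSpace ℝ (Fin 3)} {s : ℝ}
    {Q : Finset (EuclideanSpace ℝ (Fin 3))} (hQ : IsFilmOn ν s Q) {q : EuclideanSpace ℝ (Fin 3)}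
    (hqΛ : q ∉ fccStacking 1 (Real.sqrt (2 / 3))) :
    (plugSet ν s q).ncard +
      (Q.filter fun y => y ∈ fccStacking 1 (Real.sqrt (2 / 3)) ∧ dist q y = 1).card ≤ 3 := by
  have hfin := plugSet_finite ν s q
  have hdisj : Disjoint hfin.toFinset
      (Q.filter fun y => y ∈ fccStacking 1 (Real.sqrt (2 / 3)) ∧ dist q y = 1) := by
    rw [Finset.disjoint_left]
    intro y hy hy'
    rw [Set.Finite.mem_toFinset] at hy
    rw [Finset.mem_filter] at hy'
    have := hQ.2 y hy'.1 y hy.1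
    rw [dist_self] at this; linarith
  rw [Set.ncard_eq_toFinset_card _ hfin, ← Finset.card_union_of_disjoint hdisj]
  refine fcc_offLattice_unitContacts_le_three q hqΛ _ fun y hy => ?_
  rw [Finset.mem_union, Set.Finite.mem_toFinset, Finset.mem_filter] at hy
  rcases hy with ⟨⟨hyΛ, -⟩, hd⟩ | ⟨-, hyΛ, hd⟩
  · exact ⟨hyΛ, hd⟩
  · exact ⟨hyΛ, hd⟩

open scoped Classical in
/-- **The off-lattice block of a criminal has more than `3` contacts per ball**: `D(Q_off) < 3·#Q_off`. -/
theorem contactDeficiency_offLattice_lt_of_criminal {ν : EuclideanSpace ℝ (Fin 3)} {s : ℝ}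
    {Q : Finset (EuclideanSpace ℝ (Fin 3))} (hQ : IsCriminal ν s Q) :
    contactDeficiency (Q.filter fun y => y ∉ fccStacking 1 (Real.sqrt (2 / 3))) <
      3 * ((Q.filter fun y => y ∉ fccStacking 1 (Real.sqrt (2 / 3))).card : ℝ) := by
  set O := Q.filter fun y => y ∉ fccStacking 1 (Real.sqrt (2 / 3)) with hO
  have hOQ : O ⊆ Q := Finset.filter_subset _ _
  have hOne : O.Nonempty := by
    obtain ⟨q, hq, hqΛ⟩ := exists_not_mem_fcc_of_criminal hQ
    exact ⟨q, Finset.mem_filter.2 ⟨hq, hqΛ⟩⟩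
  have hblock := hQ.2.2 O hOQ hOne
  -- the right-hand side counts lattice contacts of off-lattice balls: at most `3` per ball
  have hrhs : plugCount ν s O + (((Q \ O) ×ˢ O).filter fun pq => dist pq.1 pq.2 = 1).card ≤ 3 * O.card := by
    rw [plugCount, card_cross_eq_sum, ← Finset.sum_add_distrib]
    calc ∑ q ∈ O, ((plugSet ν s q).ncard + ((Q \ O).filter fun p => dist p q = 1).card)
        ≤ ∑ q ∈ O, 3 := by
          refine Finset.sum_le_sum fun q hq => ?_
          obtain ⟨hqQ, hqΛ⟩ := Finset.mem_filter.1 hq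
          have h3 := plug_add_onLattice_le_three hQ.1 hqΛ
          have hle : ((Q \ O).filter fun p => dist p q = 1).card ≤
              (Q.filter fun y => y ∈ fccStacking 1 (Real.sqrt (2 / 3)) ∧ dist q y = 1).card := by
            refine Finset.card_le_card fun p hp => ?_
            rw [Finset.mem_filter, Finset.mem_sdiff] at hp
            rw [Finset.mem_filter]
            refine ⟨hp.1.1, ?_, by rw [dist_comm]; exact hp.2⟩
            by_contra hpΛ
            exact hp.1.2 (Finset.mem_filter.2 ⟨hp.1.1, hpΛ⟩)
          omega
      _ = 3 * O.card := by rw [Finset.sum_const, smul_eq_mul, mul_comm]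
  have hrhs' : (plugCount ν s O : ℝ) + ((((Q \ O) ×ˢ O).filter fun pq => dist pq.1 pq.2 = 1).card : ℕ)
      ≤ 3 * (O.card : ℝ) := by exact_mod_cast hrhs
  linarith

end Summit.Ventures.Crystal3D.Theorems

end
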